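import Summits.CriticalPhenomena.PercolationContinuityZ3.Theorems.Transplant.FKConnectivityAllQAntipodalRootForm3CertPar
import Summits.CriticalPhenomena.PercolationContinuityZ3.Theorems.Transplant.FKConnectivityAllQAntipodalRootFormBase
import Summits.CriticalPhenomena.PercolationContinuityZ3.Theorems.Transplant.FKConnectivityAllQAntipodalRootFormGen
import HarnessLib

/-!
# Connectivity correlation inequalities for `φ_{w,q}` — ROOT-FORM CALCULUS, file 73a (DEFINITIONS): the three-special environment `E₁ ∥ B` of an
# abstract two-special environment and an abstract box, and its link with the certificate target `Cert3.X1/X0`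

Definitions file (`--supports stmt-CriticalPhenomena-4575`), FK sub-lane `prim-bschramm-fk-2` (gen 31); builds on p205010 (kernel theorem, internal audit
signed; external expert review pending).  No named facts, no sorries.  Memo FROM-fk-2-g31-DUALITY.md §6–§7 ((G3), first half).
* `EDat.dq` — the four pattern data of a two-special datum indexed by `Fin 4` (`0 = ∅, 1 = y, 2 = z, 3 = yz`, the convention of `Cert3.PT`);
  `EDat.ptype` — its LOCAL TYPE (`Cert3.PT`: offsets relative to `Λ_∅`, pole bits);
* `comb3 a z` — pattern datum of the PARALLEL gluing of a two-special datum `a` (at one pattern) and a one-special box datum `z` (at one state) between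
  common poles: levels add plus one closed cycle per replica in which both parts join the poles; pole bits OR (cf. `Base.comb` of file 61e);
* `qOf P`, `gcombPar E₁ B : Gen.Env (Fin 3) (C₁ × C_B)` — the three-special environment of `E₁ ∥ B` (specials `0 = y, 1 = z` of `E₁`, `2 = w` of `B`);
* the LINKS `a1_link3`, `a2_link3`, `r1_link3`, `r2_link3`, `mixed_fin3`, and **`gslot1_link` / `gslot0_link`**: the two slots of the nested three-special root
  functional of `gcombPar E₁ B` at `(β, γ)` and level `J` are the certificate targets `Cert3.X1 / X0` of the local types at the relative threshold
  `J − Λ_∅(β) − L⁰(γ)` — the first half of the abstract gluing theorem (61e pattern); the regrouping of the kernel-checked table (72a–72e) is file 73b.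
[folklore]
-/

noncomputable section

namespace Summit.CriticalPhenomena.PercolationContinuityZ3.Theorems

namespace FK

namespace RootForm

namespace Base3

open Finset Base Gen

/-- the four pattern data of a two-special datum, indexed like `Cert3.PT` (`0 = ∅, 1 = y, 2 = z, 3 = yz`). [folklore] -/
def dq (e : EDat) : Fin 4 → PDat
  | 0 => e.d0
  | 1 => e.dy
  | 2 => e.dz
  | 3 => e.dyz

/-- the local type of a two-special datum. [folklore] -/
def ptype (e : EDat) : Cert3.PT :=
  ⟨e.dy.lam - e.d0.lam, e.dz.lam - e.d0.lam, e.dyz.lam - e.d0.lam, e.d0.k1, e.dy.k1, e.dz.k1, e.dyz.k1, e.d0.k2, e.dy.k2, e.dz.k2, e.dyz.k2⟩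

/-- pattern datum of a two-special datum (at one pattern) IN PARALLEL with a box datum (at one state of its special). [folklore] -/
def comb3 (a : PDat) (z : SDat) : PDat := ⟨a.lam + z.L + bit (a.k1 && z.c) + bit (a.k2 && z.cb), a.k1 || z.c, a.k2 || z.cb⟩

/-- the `E₁`-pattern (`Fin 4` code) of a three-special pattern `P ⊆ {0,1,2}` (`0 = y`, `1 = z`). [folklore] -/
def qOf (P : Finset (Fin 3)) : Fin 4 := if (0 : Fin 3) ∈ P then (if (1 : Fin 3) ∈ P then 3 else 1) else (if (1 : Fin 3) ∈ P then 2 else 0)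

/-- **The three-special environment `E₁ ∥ B`** (specials `0 = y`, `1 = z`, `2 = w`; configurations = pairs). [folklore] -/
def gcombPar {C₁ C_B : Type*} (E₁ : Env C₁) (B : C_B → BDat) : Gen.Env (Fin 3) (C₁ × C_B) := fun p =>
  ⟨fun P => comb3 (dq (E₁ p.1) (qOf P)) ((B p.2).ts (decide ((2 : Fin 3) ∈ P)))⟩

/-! ### Links with the certificate's integer functions -/

section Links

variable (e : EDat) (d : BDat)

/-- levels and bits of the local types are those of the data. [folklore] -/
theorem dL_ptype (Q : Fin 4) : (ptype e).dL Q = (dq e Q).lam - e.d0.lam := by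
  fin_cases Q <;> simp [Cert3.PT.dL, ptype, dq]
/-- see `dL_ptype`. [folklore] -/
theorem K1_ptype (Q : Fin 4) : (ptype e).K1 Q = (dq e Q).k1 := by
  fin_cases Q <;> simp [Cert3.PT.K1, ptype, dq]
/-- see `dL_ptype`. [folklore] -/
theorem K2_ptype (Q : Fin 4) : (ptype e).K2 Q = (dq e Q).k2 := by
  fin_cases Q <;> simp [Cert3.PT.K2, ptype, dq]
/-- box level at state `s` relative to `L⁰`. [folklore] -/
theorem lev_type (s : Bool) : Cert.lev d.type s = (d.ts s).L - d.t0.L := by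
  cases s <;> simp [Cert.lev, BDat.type, BDat.ts]
/-- box replica-1 bit at state `s`. [folklore] -/
theorem ccB_type (s : Bool) : Cert.ccB d.type s = (d.ts s).c := by
  cases s <;> simp [Cert.ccB, BDat.type, BDat.ts]
/-- box replica-2 bit at state `s`. [folklore] -/
theorem cbB_type (s : Bool) : Cert.cbB d.type s = (d.ts s).cb := by
  cases s <;> simp [Cert.cbB, BDat.type, BDat.ts]

/-- the composite level at `(Q, s)` relative to `Λ_∅ + L⁰`. [folklore] -/
theorem lam_link (Q : Fin 4) (s : Bool) :
    (comb3 (dq e Q) (d.ts s)).lam = Cert3.lam (ptype e) d.type Q s + e.d0.lam + d.t0.L := by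
  simp only [comb3, Cert3.lam, dL_ptype, K1_ptype, K2_ptype, lev_type, ccB_type, cbB_type, Base.bi_eq_bit]
  ring

/-- level bracket of the composite, replica-1 root. [folklore] -/
theorem a1_link3 (Q : Fin 4) (s : Bool) (J : ℤ) : (comb3 (dq e Q) (d.ts s)).a1 J =
    ((Cert.I (Cert3.lam (ptype e) d.type Q s + Cert.bi (Cert3.C1 (ptype e) d.type Q s) ≤ J - e.d0.lam - d.t0.L) : ℤ) : ℝ) := by
  unfold PDat.a1; refine Base.ind_eq_cast ?_
  have h := lam_link e d Q s
  have hb : (comb3 (dq e Q) (d.ts s)).k1 = Cert3.C1 (ptype e) d.type Q s := by simp [comb3, Cert3.C1, K1_ptype, ccB_type]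
  rw [h, hb, Base.bi_eq_bit]; omega
/-- level bracket of the composite, replica-2 root. [folklore] -/
theorem a2_link3 (Q : Fin 4) (s : Bool) (J : ℤ) : (comb3 (dq e Q) (d.ts s)).a2 J =
    ((Cert.I (Cert3.lam (ptype e) d.type Q s + Cert.bi (Cert3.C2 (ptype e) d.type Q s) ≤ J - e.d0.lam - d.t0.L) : ℤ) : ℝ) := by
  unfold PDat.a2; refine Base.ind_eq_cast ?_
  have h := lam_link e d Q s
  have hb : (comb3 (dq e Q) (d.ts s)).k2 = Cert3.C2 (ptype e) d.type Q s := by simp [comb3, Cert3.C2, K2_ptype, cbB_type]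
  rw [h, hb, Base.bi_eq_bit]; omega
/-- root-exchange bracket of the composite, replica 1. [folklore] -/
theorem r1_link3 (Q : Fin 4) (s : Bool) (J : ℤ) : (comb3 (dq e Q) (d.ts s)).r1 J =
    ((Cert.bi (Cert3.C1 (ptype e) d.type Q s) * Cert.I (Cert3.lam (ptype e) d.type Q s = J - e.d0.lam - d.t0.L) : ℤ) : ℝ) := by
  have hb : (comb3 (dq e Q) (d.ts s)).k1 = Cert3.C1 (ptype e) d.type Q s := by simp [comb3, Cert3.C1, K1_ptype, ccB_type]
  unfold PDat.r1
  rw [mul_comm, hb]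
  exact Base.ind_and_eq_cast (by rw [lam_link]; omega) _
/-- root-exchange bracket of the composite, replica 2. [folklore] -/
theorem r2_link3 (Q : Fin 4) (s : Bool) (J : ℤ) : (comb3 (dq e Q) (d.ts s)).r2 J =
    ((Cert.bi (Cert3.C2 (ptype e) d.type Q s) * Cert.I (Cert3.lam (ptype e) d.type Q s = J - e.d0.lam - d.t0.L) : ℤ) : ℝ) := by
  have hb : (comb3 (dq e Q) (d.ts s)).k2 = Cert3.C2 (ptype e) d.type Q s := by simp [comb3, Cert3.C2, K2_ptype, cbB_type]
  unfold PDat.r2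
  rw [mul_comm, hb]
  exact Base.ind_and_eq_cast (by rw [lam_link]; omega) _

end Links

/-- The six mixed patterns of three specials. [folklore] -/
theorem mixed_fin3 : Gen.mixed (Fin 3) =
    insert {2} (insert {0} (insert {0, 2} (insert {1} (insert {1, 2} ({({0, 1} : Finset (Fin 3))} : Finset (Finset (Fin 3))))))) := by
  decide

/-- a sum over the six mixed patterns, written out. [folklore] -/
theorem sum_mixed_fin3 (f : Finset (Fin 3) → ℝ) :
    ∑ P ∈ Gen.mixed (Fin 3), f P = f {2} + f {0} + f {0, 2} + f {1} + f {1, 2} + f {0, 1} := by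
  rw [mixed_fin3, sum_insert (by decide), sum_insert (by decide), sum_insert (by decide), sum_insert (by decide), sum_insert (by decide),
    sum_singleton]
  ring

/-- `qOf` and the `w`-coordinate of the eight patterns. [folklore] -/
theorem qOf_table : qOf ∅ = 0 ∧ qOf {2} = 0 ∧ qOf {0} = 1 ∧ qOf {0, 2} = 1 ∧ qOf {1} = 2 ∧ qOf {1, 2} = 2 ∧ qOf {0, 1} = 3 ∧
    qOf (univ : Finset (Fin 3)) = 3 := by
  refine ⟨?_, ?_, ?_, ?_, ?_, ?_, ?_, ?_⟩ <;> decide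

/-- **Slot-1 link**: the slot-1 integrand of the nested three-special root functional of `E₁ ∥ B` is the certificate target `Cert3.X1` at the relative
threshold. [folklore] -/
theorem gslot1_link {C₁ C_B : Type*} (E₁ : Env C₁) (B : C_B → BDat) (p : C₁ × C_B) (J : ℤ) :
    (gcombPar E₁ B p).gslot1 J = ((Cert3.X1 (ptype (E₁ p.1)) (B p.2).type (J - (E₁ p.1).d0.lam - (B p.2).t0.L) : ℤ) : ℝ) := by
  obtain ⟨h0, h2, hy, hy2, hz, hz2, hyz, hu⟩ := qOf_table
  have d2 : ∀ P : Finset (Fin 3), (gcombPar E₁ B p).d P = comb3 (dq (E₁ p.1) (qOf P)) ((B p.2).ts (decide ((2 : Fin 3) ∈ P))) := fun P => rfl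
  unfold Gen.EDat.gslot1
  rw [sum_mixed_fin3]
  simp only [d2, h0, h2, hy, hy2, hz, hz2, hyz, hu, a1_link3, r1_link3, Cert3.X1, Cert3.mixed3, List.map_cons, List.map_nil, List.sum_cons,
    List.sum_nil]
  simp only [show decide ((2 : Fin 3) ∈ (∅ : Finset (Fin 3))) = false from rfl, show decide ((2 : Fin 3) ∈ ({2} : Finset (Fin 3))) = true from rfl,
    show decide ((2 : Fin 3) ∈ ({0} : Finset (Fin 3))) = false from rfl, show decide ((2 : Fin 3) ∈ ({0, 2} : Finset (Fin 3))) = true from rfl,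
    show decide ((2 : Fin 3) ∈ ({1} : Finset (Fin 3))) = false from rfl, show decide ((2 : Fin 3) ∈ ({1, 2} : Finset (Fin 3))) = true from rfl,
    show decide ((2 : Fin 3) ∈ ({0, 1} : Finset (Fin 3))) = false from rfl, show decide ((2 : Fin 3) ∈ (univ : Finset (Fin 3))) = true from rfl]
  push_cast; ring

/-- **Slot-0 link.** [folklore] -/
theorem gslot0_link {C₁ C_B : Type*} (E₁ : Env C₁) (B : C_B → BDat) (p : C₁ × C_B) (J : ℤ) :
    (gcombPar E₁ B p).gslot0 J = ((Cert3.X0 (ptype (E₁ p.1)) (B p.2).type (J - (E₁ p.1).d0.lam - (B p.2).t0.L) : ℤ) : ℝ) := by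
  obtain ⟨h0, h2, hy, hy2, hz, hz2, hyz, hu⟩ := qOf_table
  have d2 : ∀ P : Finset (Fin 3), (gcombPar E₁ B p).d P = comb3 (dq (E₁ p.1) (qOf P)) ((B p.2).ts (decide ((2 : Fin 3) ∈ P))) := fun P => rfl
  unfold Gen.EDat.gslot0
  rw [sum_mixed_fin3]
  simp only [d2, h0, h2, hy, hy2, hz, hz2, hyz, hu, a2_link3, r2_link3, Cert3.X0, Cert3.mixed3, List.map_cons, List.map_nil, List.sum_cons,
    List.sum_nil]
  simp only [show decide ((2 : Fin 3) ∈ (∅ : Finset (Fin 3))) = false from rfl, show decide ((2 : Fin 3) ∈ ({2} : Finset (Fin 3))) = true from rfl,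
    show decide ((2 : Fin 3) ∈ ({0} : Finset (Fin 3))) = false from rfl, show decide ((2 : Fin 3) ∈ ({0, 2} : Finset (Fin 3))) = true from rfl,
    show decide ((2 : Fin 3) ∈ ({1} : Finset (Fin 3))) = false from rfl, show decide ((2 : Fin 3) ∈ ({1, 2} : Finset (Fin 3))) = true from rfl,
    show decide ((2 : Fin 3) ∈ ({0, 1} : Finset (Fin 3))) = false from rfl, show decide ((2 : Fin 3) ∈ (univ : Finset (Fin 3))) = true from rfl]
  push_cast; ring

end Base3

end RootForm

end FK

end Summit.CriticalPhenomena.PercolationContinuityZ3.Theorems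

end
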